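import Mathlib
import Summits.ValiantsHypothesis.ValiantsHypothesis.Theorems.BarrierLeverTransversalMinorLayoutsCompressionSplit

/-!
# Route BarrierLever — conjecture TT (stmt-ValiantsHypothesis-19152): compound-minor pairings, part 4 —
# the VERTEX SPLIT

Notation of parts 1–3.  `pairing_good_vsplit`: fix a symbol `x`.  On both sides let the
`κ₁`-indexed members be CONES over `x` (apex in position `none`, links `L`, `L'` avoiding `x`) and
the `κ₂`-indexed members be arbitrary tuples `D`, `D'` AVOIDING `x`.  If the link pairing `(L, L')`
and the deletion pairing `(D, D')` are good, then the whole pairing (index type `κ₁ ⊕ κ₂` on both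
sides, i.e. `deg x` agrees) is good: for `g` with row and column `x` replaced by the unit vector the
pairing matrix is block diagonal (`det_cone_minor` for the cone block), and one common good `g`
exists by `pairing_good_and`.  This is the single-symbol ("vertex") version of `pairing_good_split`
— the move that, after a cross-pair compression, re-splits a parity-locked pair of transversal
layouts (memo HOME/val-np-p2/COMPRESSION-MEMO-g2.md §4).

Definition-free, Mathlib only.  WHAT THIS IS NOT: no new case of TT by itself.
-/

-- layout Summits/ValiantsHypothesis/ValiantsHypothesis forces the duplicated namespace component
set_option linter.dupNamespace false

open Matrix Finset

namespace Summit.ValiantsHypothesis.ValiantsHypothesis.Theorems.BarrierLever.Compression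

variable {α ι : Type*} [Fintype α] [DecidableEq α] [DecidableEq ι]

/-- Cone (rows) against a tuple avoiding the apex (columns): zero row. -/
theorem det_vsplit_cross (g : Matrix ι ι ℂ) (x : ι) (R : α → ι) (C : Option α → ι)
    (hC : ∀ o, C o ≠ x) :
    ((Matrix.of fun p q : ι =>
        if p = x then (if q = x then (1 : ℂ) else 0) else (if q = x then 0 else g p q)).submatrix
      (fun o : Option α => o.elim x R) C).det = 0 := by
  classical
  refine det_eq_zero_of_row_eq_zero none fun o => ?_
  simp [submatrix_apply, hC o]

/-- Tuple avoiding the apex (rows) against a cone (columns): zero column. -/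
theorem det_vsplit_cross' (g : Matrix ι ι ℂ) (x : ι) (R : Option α → ι) (C : α → ι)
    (hR : ∀ o, R o ≠ x) :
    ((Matrix.of fun p q : ι =>
        if p = x then (if q = x then (1 : ℂ) else 0) else (if q = x then 0 else g p q)).submatrix
      R (fun o : Option α => o.elim x C)).det = 0 := by
  classical
  refine det_eq_zero_of_column_eq_zero none fun o => ?_
  simp [submatrix_apply, hR o]

/-- Two tuples avoiding the apex: the minor of the modified matrix is the minor of `g`. -/
theorem det_vsplit_away (g : Matrix ι ι ℂ) (x : ι) (R C : Option α → ι) (hR : ∀ o, R o ≠ x)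
    (hC : ∀ o, C o ≠ x) :
    ((Matrix.of fun p q : ι =>
        if p = x then (if q = x then (1 : ℂ) else 0) else (if q = x then 0 else g p q)).submatrix
      R C).det = (g.submatrix R C).det := by
  congr 1
  ext a b
  simp [submatrix_apply, hR a, hC b]

/-- VERTEX SPLIT at the symbol `x`: cones over `x` (indexed by `κ₁`) and members avoiding `x`
(indexed by `κ₂`) on both sides; if the link pairing and the deletion pairing are good, so is the
whole pairing. -/
theorem pairing_good_vsplit {κ₁ κ₂ : Type*} [Fintype κ₁] [DecidableEq κ₁] [Fintype κ₂]
    [DecidableEq κ₂] (x : ι) (L L' : κ₁ → α → ι) (D D' : κ₂ → Option α → ι)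
    (hLx : ∀ j a, L j a ≠ x) (hL'x : ∀ i b, L' i b ≠ x)
    (hDx : ∀ j o, D j o ≠ x) (hD'x : ∀ i o, D' i o ≠ x)
    (hgL : ∃ g : Matrix ι ι ℂ, (Matrix.of fun j i => (g.submatrix (L j) (L' i)).det).det ≠ 0)
    (hgD : ∃ g : Matrix ι ι ℂ, (Matrix.of fun j i => (g.submatrix (D j) (D' i)).det).det ≠ 0) :
    ∃ g : Matrix ι ι ℂ, (Matrix.of fun j i =>
      (g.submatrix
        (Sum.elim (fun j₁ => fun o : Option α => o.elim x (L j₁)) D j)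
        (Sum.elim (fun i₁ => fun o : Option α => o.elim x (L' i₁)) D' i)).det).det ≠ 0 := by
  classical
  obtain ⟨g, hg1, hg2⟩ := pairing_good_and L L' D D' hgL hgD
  set G : Matrix ι ι ℂ := Matrix.of fun p q : ι =>
      if p = x then (if q = x then (1 : ℂ) else 0) else (if q = x then 0 else g p q) with hG
  refine ⟨G, ?_⟩
  have hblock : (Matrix.of fun j i =>
      (G.submatrix
        (Sum.elim (fun j₁ => fun o : Option α => o.elim x (L j₁)) D j)
        (Sum.elim (fun i₁ => fun o : Option α => o.elim x (L' i₁)) D' i)).det) =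
      Matrix.fromBlocks (Matrix.of fun j i => (g.submatrix (L j) (L' i)).det) 0 0
        (Matrix.of fun j i => (g.submatrix (D j) (D' i)).det) := by
    ext (j | j) (i | i)
    · simp only [of_apply, Sum.elim_inl, fromBlocks_apply₁₁]
      exact det_cone_minor g x (L j) (L' i) (hLx j) (hL'x i)
    · simp only [of_apply, Sum.elim_inl, Sum.elim_inr, fromBlocks_apply₁₂, Matrix.zero_apply]
      exact det_vsplit_cross g x (L j) (D' i) (hD'x i)
    · simp only [of_apply, Sum.elim_inl, Sum.elim_inr, fromBlocks_apply₂₁, Matrix.zero_apply]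
      exact det_vsplit_cross' g x (D j) (L' i) (hDx j)
    · simp only [of_apply, Sum.elim_inr, fromBlocks_apply₂₂]
      exact det_vsplit_away g x (D j) (D' i) (hDx j) (hD'x i)
  rw [hblock, det_fromBlocks_zero₂₁]
  exact mul_ne_zero hg1 hg2

end Summit.ValiantsHypothesis.ValiantsHypothesis.Theorems.BarrierLever.Compression
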